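import Mathlib

/-!
# The identity place of a reflex type — the group-theoretic core of T4-B3 (d.2)

Kernel form of the combinatorial step used in route/T4-B3-p2.md, step (d.2): with Shimura's
notation (Shimura 1998, §8.3 Prop. 28) `S = {σ ∈ Gal(L/ℚ) : σ|_K ∈ Φ}`, `S* = {σ⁻¹ : σ ∈ S}` and
`H* = {γ : γ ∘ S = S}` (function notation), the reflex type `Φ*` consists of the embeddings of the
reflex field `K*` induced by the elements of `S*`, and the identity embedding of `K*` lies in `Φ*`
iff some `σ ∈ S` has `σ⁻¹ ∈ H*`, iff `S ∩ H* ≠ ∅`, iff the identity embedding `ε` of `K` lies in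
`Φ` (i.e. `1 ∈ S`).  The two lemmas below are exactly these equivalences for an arbitrary group `G`
and an arbitrary subset `S ⊆ G`, with `H*` the stabiliser of `S` under left translation; the third
records how `H*` moves when `S` is replaced by a translate `g • S` (used in step (d.3):
`H*'' = ḡ H*' ḡ⁻¹`).  Nothing here depends on `S` being a CM type.
-/

namespace Summit.Ventures.HodgeRepro2.ShimuraData.ReflexPlace

open Pointwise

variable {G : Type*} [Group G]

/-- Shimura's `H*` in function notation: the stabiliser of the subset `S ⊆ G` under left
translation, `{γ : γ • S = S}`. -/
abbrev leftStab (S : Set G) : Subgroup G := MulAction.stabilizer G S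

/-- `γ ∈ leftStab S` unfolds to `γ • S = S`. -/
theorem mem_leftStab_iff (S : Set G) (γ : G) : γ ∈ leftStab S ↔ γ • S = S := Iff.rfl

/-- The identity place criterion, first form: `1 ∈ S` iff some element of `S` has its inverse in
the left stabiliser of `S` — i.e. iff the identity embedding of the reflex field is induced by an
element of `S*` (T4-B3 (d.2): «`id_{K*} ∈ Φ*` iff some `σ ∈ S` has `σ⁻¹|_{K*} = id`»). -/
theorem one_mem_iff_exists_inv_mem_leftStab (S : Set G) :
    1 ∈ S ↔ ∃ σ ∈ S, σ⁻¹ ∈ leftStab S := by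
  constructor
  · intro h
    exact ⟨1, h, by simp⟩
  · rintro ⟨σ, hσ, hinv⟩
    have h : σ⁻¹ • S = S := hinv
    have : σ⁻¹ • σ ∈ σ⁻¹ • S := Set.smul_mem_smul_set hσ
    rw [h, smul_eq_mul, inv_mul_cancel] at this
    exact this

/-- The identity place criterion, second form: `1 ∈ S` iff `S` meets its left stabiliser
(T4-B3 (d.2): «`S ∩ H* ≠ ∅` iff `ε ∈ Φ`»). -/
theorem one_mem_iff_exists_mem_leftStab (S : Set G) :
    1 ∈ S ↔ ∃ σ ∈ S, σ ∈ leftStab S := by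
  rw [one_mem_iff_exists_inv_mem_leftStab]
  constructor
  · rintro ⟨σ, hσ, hinv⟩
    exact ⟨σ, hσ, by simpa using (inv_mem hinv : σ⁻¹⁻¹ ∈ leftStab S)⟩
  · rintro ⟨σ, hσ, hmem⟩
    exact ⟨σ, hσ, inv_mem hmem⟩

/-- Translating `S` conjugates its left stabiliser: `H*(g • S) = g H*(S) g⁻¹`
(T4-B3 (d.3): `S'' = ḡ ∘ S'` gives `H*'' = ḡ H*' ḡ⁻¹`). -/
theorem leftStab_smul (g : G) (S : Set G) :
    leftStab (g • S) = (leftStab S).map (MulAut.conj g).toMonoidHom :=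
  MulAction.stabilizer_smul_eq_stabilizer_map_conj g S

/-- Pointwise form of `leftStab_smul`: `γ` stabilises `g • S` iff `g⁻¹ γ g` stabilises `S`. -/
theorem mem_leftStab_smul_iff (g γ : G) (S : Set G) :
    γ ∈ leftStab (g • S) ↔ g⁻¹ * γ * g ∈ leftStab S := by
  rw [leftStab_smul, Subgroup.mem_map]
  constructor
  · rintro ⟨δ, hδ, rfl⟩
    simpa [MulAut.conj_apply, mul_assoc] using hδ
  · intro h
    exact ⟨g⁻¹ * γ * g, h, by simp [MulAut.conj_apply, mul_assoc]⟩

end Summit.Ventures.HodgeRepro2.ShimuraData.ReflexPlace
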